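import Summits.ValiantsHypothesis.ValiantsHypothesis.Theorems.DivisionGapPerDivisionHardStubPairFlipWeights

/-!
# Crux `DivisionGap.PerDivisionHard` (stmt-ValiantsHypothesis-5065), line `pair-descent-jss-endpoint` —
stub `stub_pairFlip`, part 2: arithmetic of the flip and the indifference penalty

Second helper file of the PAIR-FLIP branch (skeleton v7.2 of
`Cruxes/PerDivisionHard/Lines/pair_descent_jss_endpoint.lean`, dossier v4 §3): penalties of the
combinations `cc·g + αc·𝟙_{ep} + βc·𝟙_{em}` and `M²·q₁ + M·𝟙_{e₀} + g`, the sign of a three-level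
combination, digit extraction of a parallelism off the face, and the INDIFFERENCE PENALTY
`exists_indiffPen`: bounded, zero on the face, indifferent on the separating atom `β₀`, strict on
every other binomial atom (by non-parallelism off the face).
-/

noncomputable section

-- `Summit.ValiantsHypothesis.ValiantsHypothesis.…` is the tree's mandated single-conjunct layout
-- (Sub = Summit), so the duplicated namespace component is intended.
set_option linter.dupNamespace false

namespace Summit.ValiantsHypothesis.ValiantsHypothesis.Theorems.DivisionGapPerDivisionHard

open MvPolynomial Literature.Computability.AlgebraicComplexity
open Summit.ValiantsHypothesis.ValiantsHypothesis.Theorems.ZeroOneTransfer.Negative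
open scoped NNReal

namespace PairFlip

variable {n : ℕ}

/-! ### Arithmetic of the flip -/

/-- Penalty of the combination `cc·g + αc·𝟙_{ep} + βc·𝟙_{em}`. [folklore] -/
theorem pen_comb (g : Fin n × Fin n → ℕ) (cc αc βc : ℕ) (ep em : Fin n × Fin n)
    (m : (Fin n × Fin n) →₀ ℕ) :
    (∑ e, (cc * g e + αc * (if e = ep then 1 else 0) + βc * (if e = em then 1 else 0)) * m e) =
      cc * (∑ e, g e * m e) + αc * m ep + βc * m em := by
  rw [pen_add_left, pen_add_left, pen_mul_left, pen_mul_left, pen_mul_left, pen_indicator,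
    pen_indicator]

/-- Penalty of the three-level combination `M²·q₁ + M·𝟙_{e₀} + g`. [folklore] -/
theorem pen_levels (q₁ g : Fin n × Fin n → ℕ) (M : ℕ) (e₀ : Fin n × Fin n)
    (m : (Fin n × Fin n) →₀ ℕ) :
    (∑ e, (M ^ 2 * q₁ e + M * (if e = e₀ then 1 else 0) + g e) * m e) =
      M ^ 2 * (∑ e, q₁ e * m e) + M * m e₀ + ∑ e, g e * m e := by
  rw [pen_add_left, pen_add_left, pen_mul_left, pen_mul_left, pen_indicator]

/-- Sign of a three-level combination is the sign of its top level. [folklore] -/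
theorem levels_pos {M u v z : ℤ} (hM : |v| + |z| < M) (hu : 0 < u) : 0 < M ^ 2 * u + M * v + z := by
  have hM0 : 0 < M := lt_of_le_of_lt (add_nonneg (abs_nonneg v) (abs_nonneg z)) hM
  have hv := neg_abs_le v
  have hz := neg_abs_le z
  have h1 : M * (|v| + |z|) + M ≤ M * M := by nlinarith [Int.add_one_le_iff.mpr hM]
  have h2 : M ^ 2 ≤ M ^ 2 * u := by nlinarith
  nlinarith [abs_nonneg v, abs_nonneg z]

/-- Sign of a three-level combination is the sign of its top level. [folklore] -/
theorem levels_neg {M u v z : ℤ} (hM : |v| + |z| < M) (hu : u < 0) : M ^ 2 * u + M * v + z < 0 := by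
  have := levels_pos (M := M) (u := -u) (v := -v) (z := -z) (by rwa [abs_neg, abs_neg]) (by linarith)
  linarith

/-- **Digit extraction of a parallelism off `G`.**  If `k·(g·f − g·f') + c·(g·s − g·s') = 0` for
the place-value penalty `g` of radix `B`, with `k·f, k·f', |c|·s, |c|·s'` having entries whose sums
stay `< B`, then `k·(f − f') + c·(s − s') = 0` at every cell off `G`. [folklore] -/
theorem offG_rel_of_pen_rel (G : Finset (Fin n × Fin n)) {B : ℕ} (g : Fin n × Fin n → ℕ)
    (hg : g = fun e => if e ∈ G then 0 else B ^ (finProdFinEquiv e : ℕ)) (k : ℕ) (c : ℤ)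
    (f f' s s' : (Fin n × Fin n) →₀ ℕ)
    (hB : ∀ e, k * f e + c.toNat * s e + (-c).toNat * s' e < B)
    (hB' : ∀ e, k * f' e + c.toNat * s' e + (-c).toNat * s e < B)
    (hrel : (k : ℤ) * ((∑ e, g e * f e : ℕ) - (∑ e, g e * f' e : ℕ)) +
      c * ((∑ e, g e * s e : ℕ) - (∑ e, g e * s' e : ℕ)) = 0) :
    ∀ e ∉ G, (k : ℤ) * ((f e : ℤ) - f' e) + c * ((s e : ℤ) - s' e) = 0 := by
  set P : (Fin n × Fin n) →₀ ℕ := k • f + c.toNat • s + (-c).toNat • s' with hP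
  set Q : (Fin n × Fin n) →₀ ℕ := k • f' + c.toNat • s' + (-c).toNat • s with hQ
  have hc : (c.toNat : ℤ) - ((-c).toNat : ℤ) = c := by omega
  have hPQ : (∑ e, g e * P e) = ∑ e, g e * Q e := by
    have h1 : ((∑ e, g e * P e : ℕ) : ℤ) = k * (∑ e, g e * f e : ℕ) +
        c.toNat * (∑ e, g e * s e : ℕ) + (-c).toNat * (∑ e, g e * s' e : ℕ) := by
      rw [hP, pen_add, pen_add, pen_smul, pen_smul, pen_smul]; push_cast; ring
    have h2 : ((∑ e, g e * Q e : ℕ) : ℤ) = k * (∑ e, g e * f' e : ℕ) +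
        c.toNat * (∑ e, g e * s' e : ℕ) + (-c).toNat * (∑ e, g e * s e : ℕ) := by
      rw [hQ, pen_add, pen_add, pen_smul, pen_smul, pen_smul]; push_cast; ring
    have : ((∑ e, g e * P e : ℕ) : ℤ) = ((∑ e, g e * Q e : ℕ) : ℤ) := by
      rw [h1, h2]
      linear_combination hrel + (((∑ e, g e * s e : ℕ) : ℤ) - ((∑ e, g e * s' e : ℕ) : ℤ)) * hc
    exact_mod_cast this
  have hPe : ∀ e, P e = k * f e + c.toNat * s e + (-c).toNat * s' e := fun e => by
    simp [hP, Finsupp.add_apply, Finsupp.smul_apply]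
  have hQe : ∀ e, Q e = k * f' e + c.toNat * s' e + (-c).toNat * s e := fun e => by
    simp [hQ, Finsupp.add_apply, Finsupp.smul_apply]
  subst hg
  have hagree := eq_offG_of_pen_placePen_eq G (m₁ := P) (m₂ := Q)
    (fun e => by rw [hPe]; exact hB e) (fun e => by rw [hQe]; exact hB' e) hPQ
  intro e he
  have h := hagree e he
  rw [hPe, hQe] at h
  have h' : (k : ℤ) * f e + c.toNat * s e + (-c).toNat * s' e =
      k * f' e + c.toNat * s' e + (-c).toNat * s e := by exact_mod_cast h
  linear_combination h' - ((s e : ℤ) - s' e) * hc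


/-- Registered sub-goal form of `levels_pos`. [folklore] -/
theorem pairFlip_levels_pos :
    ∀ (M u v z : ℤ), |v| + |z| < M → 0 < u → 0 < M ^ 2 * u + M * v + z :=
  fun _ _ _ _ hM hu => levels_pos hM hu

end PairFlip

/-- Digit genericity, for a place-value penalty given by name. [folklore] -/
theorem PairFlip.eq_offG_of_pen_eq {n : ℕ} (G : Finset (Fin n × Fin n)) {B : ℕ} (g : Fin n × Fin n → ℕ)
    (hg : g = fun e => if e ∈ G then 0 else B ^ (finProdFinEquiv e : ℕ))
    {m₁ m₂ : (Fin n × Fin n) →₀ ℕ} (h₁ : ∀ e, m₁ e < B) (h₂ : ∀ e, m₂ e < B)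
    (h : (∑ e, g e * m₁ e) = ∑ e, g e * m₂ e) : ∀ e ∉ G, m₁ e = m₂ e := by
  subst hg
  exact PairFlip.eq_offG_of_pen_placePen_eq G h₁ h₂ h

namespace PairFlip
/-! ### The indifference penalty -/

/-- **The indifference penalty.**  Given the place-value penalty `g` (radix `B = 3D² + D + 1`,
`D` bounding all atom entries and degrees), a separating atom `β₀` with monomials `s, s'` and cells
`ep, em ∉ G` where `s − s'` is positive resp. negative, and non-parallelism (H2), there is a
penalty `q₁`, bounded and vanishing on `G`, which is INDIFFERENT on `β₀` and decides every other
binomial atom strictly. [folklore] -/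
theorem exists_indiffPen {n : ℕ} {ι : Type} (G : Finset (Fin n × Fin n)) (I : Finset ι)
    (F : ι → MvPolynomial (Fin n × Fin n) ℝ≥0) (β₀ : ι) (s s' : (Fin n × Fin n) →₀ ℕ)
    (ep em : Fin n × Fin n) {D B : ℕ} (g : Fin n × Fin n → ℕ)
    (hgdef : g = fun e => if e ∈ G then 0 else B ^ (finProdFinEquiv e : ℕ))
    (hB : B = 3 * (D * D) + D + 1)
    (hatomD : ∀ β ∈ I, ∀ f ∈ (F β).support, ∀ e, f e ≤ D)
    (hatomDeg : ∀ β ∈ I, ∀ f ∈ (F β).support, f.degree ≤ D)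
    (hβ₀ : β₀ ∈ I) (hs : s ∈ (F β₀).support) (hs' : s' ∈ (F β₀).support)
    (hep : ep ∉ G) (hem : em ∉ G) (hsep : s' ep < s ep) (hsem : s em < s' em)
    (H2 : ∀ β ∈ I, β ≠ β₀ → ∀ f ∈ (F β).support, ∀ f' ∈ (F β).support, f ≠ f' →
      ∀ i j : ℤ, (i ≠ 0 ∨ j ≠ 0) → ∃ e ∉ G, i * ((f e : ℤ) - f' e) ≠ j * ((s e : ℤ) - s' e)) :
    ∃ (q₁ : Fin n × Fin n → ℕ) (Q₁ : ℕ), (∀ e, q₁ e ≤ Q₁) ∧ (∀ e ∈ G, q₁ e = 0) ∧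
      ((∑ e, q₁ e * s e : ℕ) : ℤ) = ((∑ e, q₁ e * s' e : ℕ) : ℤ) ∧
      (∀ β ∈ I, β ≠ β₀ → ∀ f ∈ (F β).support, ∀ f' ∈ (F β).support, f ≠ f' →
        ((∑ e, q₁ e * f e : ℕ) : ℤ) ≠ ((∑ e, q₁ e * f' e : ℕ) : ℤ)) := by
  classical
  have hB0 : 0 < B := by rw [hB]; omega
  have hg_le : ∀ e, g e ≤ B ^ (n * n) := fun e => by rw [hgdef]; exact PairFlip.placePen_le G hB0 e
  have hgG : ∀ e ∈ G, g e = 0 := fun e he => by rw [hgdef]; exact if_pos he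
  -- `Z` bounds every place-value penalty of a relevant monomial
  obtain ⟨Z, hZ⟩ : ∃ Z : ℕ, Z = B ^ (n * n) * D := ⟨_, rfl⟩
  have hpenZ : ∀ m : (Fin n × Fin n) →₀ ℕ, m.degree ≤ D → (∑ e, g e * m e) ≤ Z := fun m hm =>
    le_trans (PairFlip.pen_le g hg_le m) (by rw [hZ]; exact Nat.mul_le_mul_left _ hm)
  obtain ⟨dp, hdp⟩ : ∃ dp : ℕ, dp = s ep - s' ep := ⟨_, rfl⟩
  obtain ⟨dm, hdm⟩ : ∃ dm : ℕ, dm = s' em - s em := ⟨_, rfl⟩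
  have hdp0 : 0 < dp := by omega
  have hdm0 : 0 < dm := by omega
  have hsD : ∀ e, s e ≤ D := hatomD β₀ hβ₀ s hs
  have hs'D : ∀ e, s' e ≤ D := hatomD β₀ hβ₀ s' hs'
  have hdpD : dp ≤ D := by have := hsD ep; omega
  have hdmD : dm ≤ D := by have := hs'D em; omega
  have hdpZ : (dp : ℤ) = (s ep : ℤ) - s' ep := by omega
  have hdmZ : (dm : ℤ) = (s' em : ℤ) - s em := by omega
  obtain ⟨t, ht⟩ : ∃ t : ℤ, t = ((∑ e, g e * s e : ℕ) : ℤ) - ((∑ e, g e * s' e : ℕ) : ℤ) := ⟨_, rfl⟩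
  have hsdeg : s.degree ≤ D := hatomDeg β₀ hβ₀ s hs
  have hs'deg : s'.degree ≤ D := hatomDeg β₀ hβ₀ s' hs'
  have htZ : |t| ≤ Z := by
    have h1 : ((∑ e, g e * s e : ℕ) : ℤ) ≤ Z := by exact_mod_cast hpenZ s hsdeg
    have h2 : ((∑ e, g e * s' e : ℕ) : ℤ) ≤ Z := by exact_mod_cast hpenZ s' hs'deg
    have h3 : (0 : ℤ) ≤ ((∑ e, g e * s e : ℕ) : ℤ) := Nat.cast_nonneg _
    have h4 : (0 : ℤ) ≤ ((∑ e, g e * s' e : ℕ) : ℤ) := Nat.cast_nonneg _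
    rw [ht, abs_le]; constructor <;> linarith only [h1, h2, h3, h4]
  obtain ⟨tp, htp⟩ : ∃ tp : ℕ, tp = t.toNat := ⟨_, rfl⟩
  obtain ⟨tm, htm⟩ : ∃ tm : ℕ, tm = (-t).toNat := ⟨_, rfl⟩
  have htpm : (tp : ℤ) - tm = t := by rw [htp, htm]; omega
  obtain ⟨q₁, hq₁def⟩ : ∃ q₁ : Fin n × Fin n → ℕ, q₁ = fun e => dp * dm * g e +
      dm * tm * (if e = ep then 1 else 0) + dp * tp * (if e = em then 1 else 0) := ⟨_, rfl⟩
  have hpen₁ : ∀ m : (Fin n × Fin n) →₀ ℕ,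
      (∑ e, q₁ e * m e) = dp * dm * (∑ e, g e * m e) + dm * tm * m ep + dp * tp * m em :=
    fun m => by rw [hq₁def]; exact PairFlip.pen_comb g (dp * dm) (dm * tm) (dp * tp) ep em m
  -- indifference on `β₀`
  have hindiff : ((∑ e, q₁ e * s e : ℕ) : ℤ) = ((∑ e, q₁ e * s' e : ℕ) : ℤ) := by
    rw [hpen₁ s, hpen₁ s']
    simp only [Nat.cast_add, Nat.cast_mul]
    have e1 : ((∑ e, g e * s e : ℕ) : ℤ) = t + ((∑ e, g e * s' e : ℕ) : ℤ) := by rw [ht]; ring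
    rw [e1]
    -- `tp · tm = 0`-free identity: `t = tp - tm`
    have hcase : (tp : ℤ) = t ∧ (tm : ℤ) = 0 ∨ (tp : ℤ) = 0 ∧ (tm : ℤ) = -t := by
      rw [htp, htm]; omega
    rcases hcase with ⟨h1, h2⟩ | ⟨h1, h2⟩
    · rw [h1, h2]; linear_combination (dp : ℤ) * t * hdmZ
    · rw [h1, h2]; linear_combination (dm : ℤ) * t * hdpZ
  -- strict decisions of the other binomial atoms under `q₁`
  have hstrict : ∀ β ∈ I, β ≠ β₀ → ∀ f ∈ (F β).support, ∀ f' ∈ (F β).support, f ≠ f' →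
      ((∑ e, q₁ e * f e : ℕ) : ℤ) ≠ ((∑ e, q₁ e * f' e : ℕ) : ℤ) := by
    intro β hβ hne f hf f' hf' hff' heq
    rw [hpen₁ f, hpen₁ f'] at heq
    simp only [Nat.cast_add, Nat.cast_mul] at heq
    have hfD : ∀ e, f e ≤ D := hatomD β hβ f hf
    have hf'D : ∀ e, f' e ≤ D := hatomD β hβ f' hf'
    -- the relation `k (Gf - Gf') + c (Gs - Gs') = 0`
    have hrel : ∃ (k : ℕ) (c : ℤ), 0 < k ∧ k ≤ D ∧ |c| ≤ D ∧
        (k : ℤ) * (((∑ e, g e * f e : ℕ) : ℤ) - ((∑ e, g e * f' e : ℕ) : ℤ)) +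
          c * (((∑ e, g e * s e : ℕ) : ℤ) - ((∑ e, g e * s' e : ℕ) : ℤ)) = 0 := by
      have hcase : (0 ≤ t ∧ (tp : ℤ) = t ∧ (tm : ℤ) = 0) ∨ (t < 0 ∧ (tp : ℤ) = 0 ∧ (tm : ℤ) = -t) := by
        rw [htp, htm]; omega
      rcases hcase with ⟨_, h1, h2⟩ | ⟨_, h1, h2⟩
      · -- `dm (Gf - Gf') + (f em - f' em) t = 0`
        refine ⟨dm, (f em : ℤ) - f' em, hdm0, hdmD, ?_, ?_⟩
        · have a1 : ((f em : ℕ) : ℤ) ≤ D := by exact_mod_cast hfD em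
          have a2 : ((f' em : ℕ) : ℤ) ≤ D := by exact_mod_cast hf'D em
          have a3 : (0 : ℤ) ≤ f em := Nat.cast_nonneg _
          have a4 : (0 : ℤ) ≤ f' em := Nat.cast_nonneg _
          rw [abs_le]; constructor <;> linarith only [a1, a2, a3, a4]
        · rw [h1, h2] at heq
          rw [← ht]
          have hdp0' : (dp : ℤ) ≠ 0 := by exact_mod_cast hdp0.ne'
          have key : (dp : ℤ) * ((dm : ℤ) * (((∑ e, g e * f e : ℕ) : ℤ) - ((∑ e, g e * f' e : ℕ) : ℤ)) +
              ((f em : ℤ) - f' em) * t) = 0 := by linear_combination heq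
          rcases mul_eq_zero.mp key with h0 | h0
          · exact absurd h0 hdp0'
          · linear_combination h0
      · -- `dp (Gf - Gf') - (f ep - f' ep) t = 0`
        refine ⟨dp, -((f ep : ℤ) - f' ep), hdp0, hdpD, ?_, ?_⟩
        · have a1 : ((f ep : ℕ) : ℤ) ≤ D := by exact_mod_cast hfD ep
          have a2 : ((f' ep : ℕ) : ℤ) ≤ D := by exact_mod_cast hf'D ep
          have a3 : (0 : ℤ) ≤ f ep := Nat.cast_nonneg _
          have a4 : (0 : ℤ) ≤ f' ep := Nat.cast_nonneg _
          rw [abs_le]; constructor <;> linarith only [a1, a2, a3, a4]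
        · rw [h1, h2] at heq
          rw [← ht]
          have hdm0' : (dm : ℤ) ≠ 0 := by exact_mod_cast hdm0.ne'
          have key : (dm : ℤ) * ((dp : ℤ) * (((∑ e, g e * f e : ℕ) : ℤ) - ((∑ e, g e * f' e : ℕ) : ℤ)) +
              -((f ep : ℤ) - f' ep) * t) = 0 := by linear_combination heq
          rcases mul_eq_zero.mp key with h0 | h0
          · exact absurd h0 hdm0'
          · linear_combination h0
    obtain ⟨k, c, hk0, hkD, hcD, hrel⟩ := hrel
    -- entries of the comparison vectors stay below `B`
    have hcp : c.toNat ≤ D := Int.toNat_le.mpr (abs_le.mp hcD).2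
    have hcm : (-c).toNat ≤ D := Int.toNat_le.mpr (by linarith only [(abs_le.mp hcD).1])
    have hbnd : ∀ (x y z : (Fin n × Fin n) →₀ ℕ), (∀ e, x e ≤ D) → (∀ e, y e ≤ D) → (∀ e, z e ≤ D) →
        ∀ e, k * x e + c.toNat * y e + (-c).toNat * z e < B := by
      intro x y z hx hy hz e
      have h1 : k * x e ≤ D * D := Nat.mul_le_mul hkD (hx e)
      have h2 : c.toNat * y e ≤ D * D := Nat.mul_le_mul hcp (hy e)
      have h3 : (-c).toNat * z e ≤ D * D := Nat.mul_le_mul hcm (hz e)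
      rw [hB]; omega
    have hoff := PairFlip.offG_rel_of_pen_rel G g hgdef k c f f' s s' (hbnd f s s' hfD hsD hs'D)
      (hbnd f' s' s hf'D hs'D hsD) hrel
    -- contradiction with non-parallelism (H2) for `i = k`, `j = -c`
    obtain ⟨e, heG, hne'⟩ := H2 β hβ hne f hf f' hf' hff' k (-c) (Or.inl (by exact_mod_cast hk0.ne'))
    exact hne' (by linear_combination hoff e heG)
  refine ⟨q₁, dp * dm * B ^ (n * n) + dm * tm + dp * tp, fun e => ?_, fun e he => ?_, hindiff, hstrict⟩
  · simp only [hq₁def]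
    have h1 : dp * dm * g e ≤ dp * dm * B ^ (n * n) := Nat.mul_le_mul_left _ (hg_le e)
    have h2 : dm * tm * (if e = ep then 1 else 0) ≤ dm * tm := by split_ifs <;> simp
    have h3 : dp * tp * (if e = em then 1 else 0) ≤ dp * tp := by split_ifs <;> simp
    omega
  · have h1 : e ≠ ep := fun h => hep (h ▸ he)
    have h2 : e ≠ em := fun h => hem (h ▸ he)
    simp only [hq₁def, hgG e he, if_neg h1, if_neg h2]; ring

end PairFlip

/-- In a finset with at most two elements containing `l₁ ≠ l₂`, two distinct members are
`l₁, l₂` in some order. [folklore] -/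
theorem PairFlip.pair_cases {κ : Type} [DecidableEq κ] {L : Finset κ} (hL : L.card ≤ 2)
    {l₁ l₂ x y : κ} (h₁ : l₁ ∈ L) (h₂ : l₂ ∈ L) (h₁₂ : l₁ ≠ l₂) (hx : x ∈ L) (hy : y ∈ L)
    (hxy : x ≠ y) : (x = l₁ ∧ y = l₂) ∨ (x = l₂ ∧ y = l₁) := by
  have hsub : ({l₁, l₂} : Finset κ) ⊆ L := by
    intro z hz
    rcases Finset.mem_insert.mp hz with rfl | hz
    · exact h₁
    · rw [Finset.mem_singleton.mp hz]; exact h₂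
  have hcard : ({l₁, l₂} : Finset κ).card = 2 := Finset.card_pair h₁₂
  have hLeq : L = {l₁, l₂} :=
    (Finset.eq_of_subset_of_card_le hsub (by rw [hcard]; exact hL)).symm
  rw [hLeq] at hx hy
  simp only [Finset.mem_insert, Finset.mem_singleton] at hx hy
  rcases hx with rfl | rfl <;> rcases hy with rfl | rfl
  · exact absurd rfl hxy
  · exact Or.inl ⟨rfl, rfl⟩
  · exact Or.inr ⟨rfl, rfl⟩
  · exact absurd rfl hxy


end Summit.ValiantsHypothesis.ValiantsHypothesis.Theorems.DivisionGapPerDivisionHard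

end
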